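import Summits.KontsevichZagierPeriods.KontsevichZagierPeriods.Theorems.DihedralNormalForm.Negative.LoadBearing
import Summits.KontsevichZagierPeriods.KontsevichZagierPeriods.Theorems.DihedralNormalForm.Negative.RuleOneBDerivable

/-!
# `DihedralNormalForm` (stmt-KontsevichZagierPeriods-3912): negative side — tightness of the rule-(2) obstruction

Landed copy of §10 of the crux work file `Cruxes/DihedralNormalForm/Disproof.lean` (cdisprove seat,
generation 3).  The rule-(2) analysis shows that the witness `letterRep = [Δ₂, 1/(1-t₁)]` (letter
at the LAST coordinate) is not congruent to the MZV word closure inside the sub-calculus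
`relationsWithoutCoV = closure(1a ∪ 1b ∪ 3)` (work file §5, §9).  This file certifies that the
obstruction is EXACTLY the orientation of the letter relative to `Fin.last`, i.e. that what
rule (2) must supply is a transposition of coordinates: the MIRROR witness
`mirrorRep = [Δ₂, 1/t₀]` (letter at the FIRST coordinate; also a genus-zero representation,
`isGenusZero_mirrorRep`) DOES close without rule (2) — `cruxWithoutChangeOfVariables_mirror`:
`[Δ₂, 1/t₀] ≡ [pt, 1]` modulo `relationsWithoutCoV`, by six instances of (1a)/(3): close the null
faces (`band_split` + the null piece `nullRep`), ONE Newton–Leibniz move with the rational primitive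
`t₁/t₀` down to `[Δ₁, 1]` (`band_newtonLeibniz`), close the endpoints (`icc_split` + `endsRep`), ONE
Newton–Leibniz move with primitive `t` down to the length-`0` word representation `[pt, 1]`
(`icc_newtonLeibniz`).  All side conditions (semialgebraicity, integrability on the closed band via
the null difference, the diagonal `{t₁ = t₀}` is null as a strict subspace) are discharged.

[Kontsevich–Zagier 2001, §1.2 rules (1), (3)] -/

noncomputable section

open MeasureTheory Set MvPolynomial
open Literature.NumberTheory.Transcendental Literature.ModelTheory.ExponentialFields

namespace Summit.KontsevichZagierPeriods.DihedralNormalForm.Negative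

/-! ### The closed-fibre band over `Δ₁` and its pieces -/

/-- The band `{(t₀,t₁) | 0 < t₀ < 1, 0 ≤ t₁ ≤ t₀}` in the format of the Newton–Leibniz move over
the base `oneRep = [Δ₁, 1]`. -/
def mirrorBand : Set (Fin 2 → ℝ) :=
  {z | (Fin.init z : Fin 1 → ℝ) ∈ oneRep.domain ∧ (fun _ : Fin 1 → ℝ => (0 : ℝ)) (Fin.init z) ≤ z (Fin.last 1) ∧
    z (Fin.last 1) ≤ (fun x : Fin 1 → ℝ => x 0) (Fin.init z)}

/-- Membership in the band, in coordinates. [folklore] -/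
theorem mem_mirrorBand {z : Fin 2 → ℝ} :
    z ∈ mirrorBand ↔ 0 < z 0 ∧ z 0 < 1 ∧ 0 ≤ z 1 ∧ z 1 ≤ z 0 := by
  simp only [mirrorBand, oneRep_domain, simplex_one, mem_setOf_eq]
  show ((0 < z 0 ∧ z 0 < 1) ∧ 0 ≤ z 1 ∧ z 1 ≤ z 0) ↔ _
  tauto

/-- The band is `ℚ`-semialgebraic (four polynomial inequalities). [folklore] -/
theorem isSemialgebraic_mirrorBand : IsSemialgebraic ℚ mirrorBand := by
  have h1 := isSemialgebraic_setOf_eval_lt (k := ℚ) (R := ℝ) (ι := Fin 2) (C 0) (X 0)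
  have h2 := isSemialgebraic_setOf_eval_lt (k := ℚ) (R := ℝ) (ι := Fin 2) (X 0) (C 1)
  have h3 := isSemialgebraic_setOf_eval_le (k := ℚ) (R := ℝ) (ι := Fin 2) (C 0) (X 1)
  have h4 := isSemialgebraic_setOf_eval_le (k := ℚ) (R := ℝ) (ι := Fin 2) (X 1) (X 0)
  have hEq : mirrorBand = (({x : Fin 2 → ℝ | aeval x (C 0 : MvPolynomial (Fin 2) ℚ) < aeval x (X 0 : MvPolynomial (Fin 2) ℚ)} ∩
      {x : Fin 2 → ℝ | aeval x (X 0 : MvPolynomial (Fin 2) ℚ) < aeval x (C 1 : MvPolynomial (Fin 2) ℚ)}) ∩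
      {x : Fin 2 → ℝ | aeval x (C 0 : MvPolynomial (Fin 2) ℚ) ≤ aeval x (X 1 : MvPolynomial (Fin 2) ℚ)}) ∩
      {x : Fin 2 → ℝ | aeval x (X 1 : MvPolynomial (Fin 2) ℚ) ≤ aeval x (X 0 : MvPolynomial (Fin 2) ℚ)} := by
    ext z
    simp only [mem_mirrorBand, mem_inter_iff, mem_setOf_eq, map_zero, aeval_X, map_one]
    tauto
  rw [hEq]
  exact ((h1.inter h2).inter h3).inter h4

/-- `Δ₂` lies in the band. [folklore] -/
theorem simplex_subset_mirrorBand : simplex 2 ⊆ mirrorBand := by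
  rintro z ⟨h0, h1, hanti⟩
  rw [mem_mirrorBand]
  have : z 1 < z 0 := hanti (show (0 : Fin 2) < 1 by decide)
  exact ⟨h0 0, h1 0, (h0 1).le, this.le⟩

/-- The band minus `Δ₂` lies in two lines. [folklore] -/
theorem mirrorBand_diff_subset :
    mirrorBand \ simplex 2 ⊆ {z : Fin 2 → ℝ | z 1 = 0} ∪ {z | z 1 = z 0} := by
  rintro z ⟨hz, hz'⟩
  rw [mem_mirrorBand] at hz
  obtain ⟨h0, h1, h2, h3⟩ := hz
  by_contra hcon
  simp only [mem_union, mem_setOf_eq, not_or] at hcon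
  apply hz'
  have h2' : 0 < z 1 := lt_of_le_of_ne h2 (Ne.symm hcon.1)
  have h3' : z 1 < z 0 := lt_of_le_of_ne h3 hcon.2
  refine ⟨fun i => ?_, fun i => ?_, ?_⟩
  · fin_cases i <;> assumption
  · fin_cases i
    · exact h1
    · exact h3'.trans h1
  · intro i j hij
    fin_cases i <;> fin_cases j
    · exact absurd hij (lt_irrefl _)
    · exact h3'
    · exact absurd hij (by decide)
    · exact absurd hij (lt_irrefl _)

/-- The diagonal `{t₁ = t₀}` of `ℝ²` is Lebesgue-null (a strict subspace). [folklore] -/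
theorem volume_setOf_apply_one_eq_apply_zero : volume {z : Fin 2 → ℝ | z 1 = z 0} = 0 := by
  let L : (Fin 2 → ℝ) →ₗ[ℝ] ℝ :=
    LinearMap.proj (R := ℝ) (ι := Fin 2) (φ := fun _ => ℝ) 1 -
      LinearMap.proj (R := ℝ) (ι := Fin 2) (φ := fun _ => ℝ) 0
  have hS : {z : Fin 2 → ℝ | z 1 = z 0} = (LinearMap.ker L : Set (Fin 2 → ℝ)) := by
    ext z
    simp [L, sub_eq_zero]
  rw [hS]
  refine Measure.addHaar_submodule volume (LinearMap.ker L) ?_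
  intro htop
  have : (![1, 0] : Fin 2 → ℝ) ∈ LinearMap.ker L := by rw [htop]; trivial
  simp [L] at this

/-- The band minus `Δ₂` is Lebesgue-null. [folklore] -/
theorem volume_mirrorBand_diff : volume (mirrorBand \ simplex 2) = 0 :=
  measure_mono_null mirrorBand_diff_subset
    (measure_union_null (volume_setOf_apply_eq 1 0) volume_setOf_apply_one_eq_apply_zero)

/-- `1/t₀` is absolutely integrable on `Δ₂` (dominated by the `ζ(2)` integrand). [folklore] -/
theorem integrableOn_one_div_apply_zero : IntegrableOn (fun t : Fin 2 → ℝ => 1 / t 0) (simplex 2) := by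
  have hg : IntegrableOn zeta2Rep.integrand (simplex 2) := zeta2Rep.integrableOn
  refine Integrable.mono' hg ?_ ?_
  · exact ((measurable_pi_apply 0).const_div 1).aestronglyMeasurable
  · rw [show simplex 2 = KZ.openOrderedSimplex 2 from rfl,
      ae_restrict_iff' (KZ.measurableSet_openOrderedSimplex 2)]
    refine ae_of_all _ fun t ht => ?_
    obtain ⟨h0, h1, -⟩ := ht
    have ht0 : 0 < t 0 := h0 0
    have ht1 : 0 < 1 - t 1 := by linarith [h1 1]
    have ht1' : 1 - t 1 ≤ 1 := by linarith [h0 1]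
    rw [zeta2Rep_integrand, Real.norm_eq_abs, abs_of_pos (by positivity)]
    rw [div_mul_div_comm, one_mul, div_le_div_iff₀ ht0 (by positivity)]
    nlinarith

/-- `1/t₀` is absolutely integrable on the band (it differs from `Δ₂` by a null set). [folklore] -/
theorem integrableOn_one_div_apply_zero_band : IntegrableOn (fun t : Fin 2 → ℝ => 1 / t 0) mirrorBand := by
  have hN : IntegrableOn (fun t : Fin 2 → ℝ => 1 / t 0) (mirrorBand \ simplex 2) := by
    rw [IntegrableOn, Measure.restrict_eq_zero.2 volume_mirrorBand_diff]
    exact integrable_zero_measure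
  have h := integrableOn_one_div_apply_zero.union hN
  rw [union_sdiff_cancel simplex_subset_mirrorBand] at h
  exact h

/-- **The band representation** `[band, 1/t₀]`. -/
def bandRep : KZ.IntegralRep 2 where
  domain := mirrorBand
  integrand t := 1 / t 0
  isSemialgebraic_domain := isSemialgebraic_mirrorBand
  isSemialgebraicFunOn_integrand :=
    (isSemialgebraicFunOn_aeval_div_aeval isSemialgebraic_mirrorBand 1 (X 0) fun z hz => by
      rw [mem_mirrorBand] at hz; simpa using hz.1.ne').congr fun z _ => by simp
  integrableOn := integrableOn_one_div_apply_zero_band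

/-- **The mirror witness** `[Δ₂, 1/t₀]` (the letter `1/t` at the FIRST coordinate). -/
def mirrorRep : KZ.IntegralRep 2 :=
  bandRep.restrict (simplex 2) (KZ.isSemialgebraic_openOrderedSimplex 2) simplex_subset_mirrorBand

/-- The null representation on the two boundary lines. -/
def nullRep : KZ.IntegralRep 2 :=
  bandRep.restrict (mirrorBand \ simplex 2)
    (isSemialgebraic_mirrorBand.diff (KZ.isSemialgebraic_openOrderedSimplex 2)) sdiff_subset

/-- `[Δ₂, 1/t₀]` has the genus-zero shape of the crux (`P = 1`, `b = (1,0)`, `c = 0`, `a = 0`). [folklore] -/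
theorem isGenusZero_mirrorRep : IsGenusZero mirrorRep := by
  refine ⟨1, fun _ _ => 0, ![1, 0], ![0, 0], rfl, ?_⟩
  intro t _
  show 1 / t 0 = _
  simp [gzIntegrand, Fin.prod_univ_two]

/-! ### The closed interval over the point and the constant -/

/-- The closed unit interval in the band format over `ℝ⁰`. -/
def iccSet : Set (Fin 1 → ℝ) :=
  {z | (Fin.init z : Fin 0 → ℝ) ∈ simplex 0 ∧ (fun _ : Fin 0 → ℝ => (0 : ℝ)) (Fin.init z) ≤ z (Fin.last 0) ∧
    z (Fin.last 0) ≤ (fun _ : Fin 0 → ℝ => (1 : ℝ)) (Fin.init z)}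

/-- Every point of `ℝ⁰` lies in `Δ₀`. [folklore] -/
theorem mem_simplex_zero (x : Fin 0 → ℝ) : x ∈ simplex 0 :=
  ⟨fun i => i.elim0, fun i => i.elim0, fun i => i.elim0⟩

/-- Membership in `iccSet`. [folklore] -/
theorem mem_iccSet {z : Fin 1 → ℝ} : z ∈ iccSet ↔ 0 ≤ z 0 ∧ z 0 ≤ 1 := by
  simp only [iccSet, mem_setOf_eq, mem_simplex_zero, true_and]
  rfl

/-- `iccSet` is `ℚ`-semialgebraic. [folklore] -/
theorem isSemialgebraic_iccSet : IsSemialgebraic ℚ iccSet := by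
  have h1 := isSemialgebraic_setOf_eval_le (k := ℚ) (R := ℝ) (ι := Fin 1) (C 0) (X 0)
  have h2 := isSemialgebraic_setOf_eval_le (k := ℚ) (R := ℝ) (ι := Fin 1) (X 0) (C 1)
  have hEq : iccSet = {x : Fin 1 → ℝ | aeval x (C 0 : MvPolynomial (Fin 1) ℚ) ≤ aeval x (X 0 : MvPolynomial (Fin 1) ℚ)} ∩
      {x : Fin 1 → ℝ | aeval x (X 0 : MvPolynomial (Fin 1) ℚ) ≤ aeval x (C 1 : MvPolynomial (Fin 1) ℚ)} := by
    ext z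
    simp only [mem_iccSet, mem_inter_iff, mem_setOf_eq, map_zero, aeval_X, map_one]
  rw [hEq]
  exact h1.inter h2

/-- `[ [0,1], 1 ]`. -/
def iccRep : KZ.IntegralRep 1 where
  domain := iccSet
  integrand _ := 1
  isSemialgebraic_domain := isSemialgebraic_iccSet
  isSemialgebraicFunOn_integrand := (isSemialgebraicFunOn_aeval isSemialgebraic_iccSet 1).congr fun z _ => by simp
  integrableOn := by
    refine integrableOn_const ?_
    refine ne_of_lt (lt_of_le_of_lt (measure_mono (fun z hz => ?_ : iccSet ⊆ Set.Icc (0 : Fin 1 → ℝ) 1)) ?_)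
    · rw [mem_iccSet] at hz
      exact ⟨fun i => by fin_cases i; exact hz.1, fun i => by fin_cases i; exact hz.2⟩
    · rw [Real.volume_Icc_pi]; simp

/-- `Δ₁ ⊆ [0,1]`. [folklore] -/
theorem simplex_one_subset_iccSet : simplex 1 ⊆ iccSet := by
  intro z hz
  rw [simplex_one] at hz
  rw [mem_iccSet]
  exact ⟨hz.1.le, hz.2.le⟩

/-- The two endpoints. -/
def endsRep : KZ.IntegralRep 1 :=
  iccRep.restrict (iccSet \ simplex 1) (isSemialgebraic_iccSet.diff (KZ.isSemialgebraic_openOrderedSimplex 1))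
    sdiff_subset

/-- The endpoints are null. [folklore] -/
theorem volume_iccSet_diff : volume (iccSet \ simplex 1) = 0 := by
  refine measure_mono_null (fun z hz => ?_) (measure_union_null (volume_setOf_apply_eq (n := 0) 0 0)
    (volume_setOf_apply_eq (n := 0) 0 1))
  obtain ⟨hz, hz'⟩ := hz
  rw [mem_iccSet] at hz
  rw [simplex_one] at hz'
  simp only [mem_setOf_eq, not_and, not_lt] at hz'
  simp only [mem_union, mem_setOf_eq]
  rcases hz.1.lt_or_eq with h | h
  · exact Or.inr (le_antisymm hz.2 (hz' h))
  · exact Or.inl h.symm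

/-- The constant `[pt, 1]` as a word representation of length `0`. -/
def ptRep : KZ.IntegralRep 0 where
  domain := simplex 0
  integrand _ := 1
  isSemialgebraic_domain := KZ.isSemialgebraic_openOrderedSimplex 0
  isSemialgebraicFunOn_integrand :=
    (isSemialgebraicFunOn_aeval (KZ.isSemialgebraic_openOrderedSimplex 0) 1).congr fun z _ => by simp
  integrableOn := integrableOn_const (by
    rw [show simplex 0 = univ from eq_univ_of_forall mem_simplex_zero, volume_pi, Measure.pi_univ]; simp)

/-- `[pt, 1]` is a generator of the word closure. [folklore] -/
theorem of_ptRep_mem_wordRepSet : KZ.of ptRep ∈ wordRepSet :=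
  ⟨0, Fin.elim0, 1, ptRep, rfl, fun t _ => by simp [ptRep], rfl⟩

/-! ### The chain, inside `relationsWithoutCoV` -/

/-- Domain additivity lies in the sub-calculus. [folklore] -/
theorem domainAdd_subset : KZ.domainAddRel ⊆ (relationsWithoutCoV : Set KZ.FormalRep) := fun _ hc =>
  AddSubgroup.subset_closure (Or.inl (Or.inl hc))

/-- Newton–Leibniz lies in the sub-calculus. [folklore] -/
theorem newtonLeibniz_subset : KZ.newtonLeibnizRel ⊆ (relationsWithoutCoV : Set KZ.FormalRep) := fun _ hc =>
  AddSubgroup.subset_closure (Or.inr hc)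

/-- A representation on a null domain lies in the sub-calculus (`[N] − [N] − [N]` is a
domain-additivity instance). [folklore] -/
theorem of_mem_relationsWithoutCoV_of_null {n : ℕ} (r : KZ.IntegralRep n) (h : volume r.domain = 0) :
    KZ.of r ∈ relationsWithoutCoV := by
  have h1 : KZ.of r - KZ.of r - KZ.of r ∈ relationsWithoutCoV :=
    domainAdd_subset ⟨n, r, r, r, (union_self _).symm, by rwa [inter_self], fun _ _ => rfl,
      fun _ _ => rfl, rfl⟩
  have : KZ.of r - KZ.of r - KZ.of r = -KZ.of r := by abel
  rw [this] at h1
  exact neg_mem_iff.1 h1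

/-- `[band] − [Δ₂ piece] − [null piece]` is a domain-additivity instance. [folklore] -/
theorem band_split : KZ.of bandRep - KZ.of mirrorRep - KZ.of nullRep ∈ KZ.domainAddRel := by
  refine ⟨2, bandRep, mirrorRep, nullRep, ?_, ?_, fun _ _ => rfl, fun _ _ => rfl, rfl⟩
  · exact (union_sdiff_cancel simplex_subset_mirrorBand).symm
  · show volume (simplex 2 ∩ (mirrorBand \ simplex 2)) = 0
    rw [inter_sdiff_self]; exact measure_empty

/-- `[band, 1/t₀] − [Δ₁, 1]` is ONE Newton–Leibniz move with the primitive `t₁/t₀`. [folklore] -/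
theorem band_newtonLeibniz : KZ.of bandRep - KZ.of oneRep ∈ KZ.newtonLeibnizRel := by
  refine ⟨1, bandRep, oneRep, fun _ => (0 : ℝ), fun x => x 0, fun z => z 1 / z 0, ?_, ?_, ?_, ?_, rfl,
    ?_, ?_, ?_, rfl⟩
  · exact (isSemialgebraicFunOn_aeval_div_aeval isSemialgebraic_mirrorBand (X 1) (X 0) fun z hz => by
      rw [mem_mirrorBand] at hz; simpa using hz.1.ne').congr fun z _ => by simp
  · exact (isSemialgebraicFunOn_natCast oneRep.isSemialgebraic_domain 0).congr fun x _ => by simp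
  · exact (isSemialgebraicFunOn_aeval oneRep.isSemialgebraic_domain (X 0)).congr fun x _ => by simp
  · intro x hx
    rw [oneRep_domain, simplex_one] at hx
    exact hx.1.le
  · intro x _
    have h0 : ∀ t : ℝ, (Fin.snoc x t : Fin 2 → ℝ) 0 = x 0 := fun t => by simp [Fin.snoc]
    have h1 : ∀ t : ℝ, (Fin.snoc x t : Fin 2 → ℝ) 1 = t := fun t => by simp [Fin.snoc]
    simp only [h0, h1]
    fun_prop
  · intro x hx t _
    rw [oneRep_domain, simplex_one] at hx
    have h0 : ∀ s : ℝ, (Fin.snoc x s : Fin 2 → ℝ) 0 = x 0 := fun s => by simp [Fin.snoc]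
    have h1 : ∀ s : ℝ, (Fin.snoc x s : Fin 2 → ℝ) 1 = s := fun s => by simp [Fin.snoc]
    show HasDerivAt (fun s : ℝ => (Fin.snoc x s : Fin 2 → ℝ) 1 / (Fin.snoc x s : Fin 2 → ℝ) 0)
      (1 / (Fin.snoc x t : Fin 2 → ℝ) 0) t
    simp only [h0, h1]
    have hd := (hasDerivAt_id t).div_const (x 0)
    simp only [id, one_div] at hd ⊢
    exact hd
  · intro x hx
    rw [oneRep_domain, simplex_one] at hx
    have h0 : ∀ s : ℝ, (Fin.snoc x s : Fin 2 → ℝ) 0 = x 0 := fun s => by simp [Fin.snoc]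
    have h1 : ∀ s : ℝ, (Fin.snoc x s : Fin 2 → ℝ) 1 = s := fun s => by simp [Fin.snoc]
    rw [oneRep_integrand]
    simp only [h0, h1]
    field_simp [hx.1.ne']
    ring

/-- `[[0,1]] − [Δ₁] − [endpoints]` is a domain-additivity instance. [folklore] -/
theorem icc_split : KZ.of iccRep - KZ.of oneRep - KZ.of endsRep ∈ KZ.domainAddRel := by
  refine ⟨1, iccRep, oneRep, endsRep, ?_, ?_, fun x _ => (oneRep_integrand x).symm, fun _ _ => rfl, rfl⟩
  · show iccSet = simplex 1 ∪ (iccSet \ simplex 1)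
    exact (union_sdiff_cancel simplex_one_subset_iccSet).symm
  · show volume (simplex 1 ∩ (iccSet \ simplex 1)) = 0
    rw [inter_sdiff_self]; exact measure_empty

/-- `[[0,1], 1] − [pt, 1]` is ONE Newton–Leibniz move with the primitive `t`. [folklore] -/
theorem icc_newtonLeibniz : KZ.of iccRep - KZ.of ptRep ∈ KZ.newtonLeibnizRel := by
  refine ⟨0, iccRep, ptRep, fun _ => (0 : ℝ), fun _ => (1 : ℝ), fun z => z 0, ?_, ?_, ?_,
    fun _ _ => zero_le_one, rfl, ?_, ?_, ?_, rfl⟩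
  · exact (isSemialgebraicFunOn_aeval isSemialgebraic_iccSet (X 0)).congr fun z _ => by simp
  · exact (isSemialgebraicFunOn_natCast ptRep.isSemialgebraic_domain 0).congr fun x _ => by simp
  · exact (isSemialgebraicFunOn_natCast ptRep.isSemialgebraic_domain 1).congr fun x _ => by simp
  · intro x _
    have : ∀ t : ℝ, (Fin.snoc x t : Fin 1 → ℝ) 0 = t := fun t => by simp [Fin.snoc]
    simp only [this]
    exact continuousOn_id
  · intro x _ t _
    have : ∀ s : ℝ, (Fin.snoc x s : Fin 1 → ℝ) 0 = s := fun s => by simp [Fin.snoc]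
    simp only [this]
    exact hasDerivAt_id t
  · intro x _
    have : ∀ s : ℝ, (Fin.snoc x s : Fin 1 → ℝ) 0 = s := fun s => by simp [Fin.snoc]
    simp only [this]
    show (1 : ℝ) = 1 - 0
    ring

/-- **TIGHTNESS of the rule-(2) obstruction.** The mirror image `[Δ₂, 1/t₀]` of the witness (the
letter at the FIRST coordinate) DOES close without rule (2): closing null faces (two
domain-additivity moves and their null pieces), one Newton–Leibniz move with primitive `t₁/t₀`
down to `[Δ₁, 1]`, closing the endpoints, and one Newton–Leibniz move with primitive `t` down to
the word representation `[pt, 1]` — six instances of (1a)/(3).  So the obstruction of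
`not_cruxWithoutChangeOfVariables` is exactly the ORIENTATION of the letter relative to the last
coordinate: what rule (2) must supply is a transposition. [folklore] -/
theorem cruxWithoutChangeOfVariables_mirror :
    ∃ m ∈ AddSubgroup.closure wordRepSet, KZ.of mirrorRep - m ∈ relationsWithoutCoV := by
  refine ⟨KZ.of ptRep, AddSubgroup.subset_closure of_ptRep_mem_wordRepSet, ?_⟩
  have e1 := domainAdd_subset band_split
  have e2 : KZ.of nullRep ∈ relationsWithoutCoV := of_mem_relationsWithoutCoV_of_null _ volume_mirrorBand_diff
  have e3 := newtonLeibniz_subset band_newtonLeibniz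
  have e4 := domainAdd_subset icc_split
  have e5 : KZ.of endsRep ∈ relationsWithoutCoV := of_mem_relationsWithoutCoV_of_null _ volume_iccSet_diff
  have e6 := newtonLeibniz_subset icc_newtonLeibniz
  have key : KZ.of mirrorRep - KZ.of ptRep =
      (-(KZ.of bandRep - KZ.of mirrorRep - KZ.of nullRep) - KZ.of nullRep + (KZ.of bandRep - KZ.of oneRep)) +
      (-(KZ.of iccRep - KZ.of oneRep - KZ.of endsRep) - KZ.of endsRep + (KZ.of iccRep - KZ.of ptRep)) := by
    abel
  rw [key]
  exact add_mem (add_mem (sub_mem (neg_mem e1) e2) e3) (add_mem (sub_mem (neg_mem e4) e5) e6)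

end Summit.KontsevichZagierPeriods.DihedralNormalForm.Negative
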